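import Summits.BirchSwinnertonDyer.Rank1Residual.X11b.AnticyclotomicSplitPlaces
import Literature.NumberTheory.GaloisRepresentations.FrobeniusPlaces
import Literature.NumberTheory.EllipticCurves.ZpExtensionProofs
import HarnessLib

/-!
# X11b, route R1 — places over primes INERT in the quadratic field split completely in the
# anticyclotomic tower: the Frobenius-form hypothesis of `AnticyclotomicSplitPlaces` DISCHARGED

HONEST FRAMING (cell `b2b-bsdres`, run/shared/lean/b2b/bsd-rank1-residual/, verbatim in every
file): the goal of the cell is to DELETE the COMBINATION-SHAPED residual classes of the
Birch–Swinnerton-Dyer formula for ALL analytic-rank `≤ 1` elliptic curves over `ℚ` — "full BSD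
formula for every rank `≤ 1` curve in class `C`" assembled STRICTLY from published theorems — so
that the rank-`≤ 1` remainder becomes exactly the CONSTRUCTION-SHAPED classes, which are TYPED
(missing-input `Prop`s), NOT attempted. This is not "finishing BSD". Sub-cell
`b2b-bsdres-multr1-p1` (X11b, route R1 = Castella 2018 Thm. A re-proved along the author's
erratum); a RESEARCH ROUTE; no claim beyond the stated class; X11b stays CONSTRUCTION-SHAPED;
nothing here changes a label; no named fact is minted (proved theorems only; no `sorry`).

## Why this file

`AnticyclotomicSplitPlaces` (gen 10) proved that for an ANTICYCLOTOMIC `ℤ_p`-extension `κ` of `K` and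
a finite place `v ∤ p` carrying an arithmetic Frobenius `φ` at the chosen prime `𝔓₀ ∣ v` of `\bar ℤ_K`
whose restriction to `Γ_ℚ` is a square `ρ²` with `ρ ∉ res(Γ_K)` — "`Frob_v = Frob_ℓ²`, `ℓ` inert", in
FROBENIUS FORM — the decomposition group `D_v` lies in `ker κ` (the place splits completely in
`K_∞/K`) and Castella's away condition at `v` descends. It left the construction of `φ, ρ` from
"`v` lies over a rational prime INERT in `K`" as a hypothesis. This file discharges it with the tree's
Frobenius dictionary for `res : Γ_K → Γ_ℚ` (`FrobeniusPlaces`, Neukirch I §9 (9.4)–(9.5), Marcus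
Ch. 4 Thm. 29):

* `exists_frob_restrict_eq_sq_of_inertiaDeg_eq_two` — for `[K : ℚ] = 2` and a place `v` of `K` of
  residue degree `f(v|ℓ) = 2` over the place `ℓ` of `ℚ` below it, there are an arithmetic Frobenius
  `φ ∈ Γ_K` at `𝔓₀ = adicCompletionPrime K v` and `ρ ∈ Γ_ℚ ∖ res(Γ_K)` with `res φ = ρ²`: take `ρ = Φ`
  an arithmetic Frobenius of `Γ_ℚ` at `𝔓₀ ∩ \bar ℤ_ℚ` (exists, `exists_isArithFrobAt_of_mem_primesAbove_holds`);
  `Φ ∉ res(Γ_K)` because a Frobenius in `res(Γ_K)` forces `f = 1`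
  (`inertiaDeg_eq_one_of_isArithFrobAt_absGaloisRestrict`); `Φ² ∈ res(Γ_K)` (index `2`,
  `inv_mul_mem_range_absGaloisRestrict`), and any `φ` with `res φ = Φ^{f}` is a Frobenius at `𝔓₀`
  (`isArithFrobAt_of_absGaloisRestrict_eq_pow`);
* **`IsAnticyclotomic.decomp_le_kerSubgroup_of_inertiaDeg_eq_two`**: hence for anticyclotomic `κ`
  and `v ∤ p` of residue degree `2`, `D_v ≤ ker κ` — the places over inert primes SPLIT COMPLETELY in
  the anticyclotomic `ℤ_p`-extension (dihedral `Gal(K_∞/ℚ)`);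
* **`IsAnticyclotomic.resOfLe_mem_awayKer_iff_of_inertiaDeg_eq_two`**: and Castella's away
  condition at such `v` descends from `K_∞` to `K`, for ANY discrete `Γ_K`-module.

(For the control theorem of route R1 the good places are handled for every `ℤ_p`-extension by
`AnticyclotomicGoodPlaces`; this file adds the BAD places over inert primes — none on an erratum
field, where every bad prime other than the ramified `q` splits — and records the classical
splitting fact in the tree's vocabulary.)

References: [GreenbergLNM1716] §3 p. 87 (primes splitting completely); [Washington1997] §13;
[NeukirchANT1999] I §9 (9.4)–(9.5); [Marcus2018] Ch. 4, Thm. 29; Brink, *Prime decomposition in the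
anti-cyclotomic extension*, Math. Comp. 76 (2007), §1 (inert primes split completely).
-/

noncomputable section

open scoped Classical

open NumberField IsDedekindDomain Field
open Literature.NumberTheory.EllipticCurves Literature.NumberTheory.EllipticCurves.GreenbergSelmer
open Literature.NumberTheory.GaloisRepresentations IsDedekindDomain.HeightOneSpectrum

namespace Summit.BirchSwinnertonDyer.Rank1Residual.X11b.AcSelmer

variable {K : Type} [Field K] [NumberField K]

/-! ## `Frob_v = Frob_ℓ²` at a place of residue degree two of a quadratic field -/

/-- **A place of residue degree `2` of a quadratic field carries a Frobenius that restricts to the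
square of an element of `Γ_ℚ ∖ res(Γ_K)`.** For `[K : ℚ] = 2`, `v` a finite place of `K` above the
place `ℓ` of `ℚ` with `f(v|ℓ) = 2` (i.e. `ℓ` INERT in `K`): there are an arithmetic Frobenius `φ ∈ Γ_K`
at `𝔓₀ = adicCompletionPrime K v` and `ρ ∈ Γ_ℚ`, `ρ ∉ res(Γ_K)`, with `res φ = ρ·ρ`. (`ρ = Frob_ℓ` at
`𝔓₀ ∩ \bar ℤ_ℚ`; it is not in `res(Γ_K)` since that would force `f = 1`; `ρ²` lies in the index-`2`
image and any preimage is a Frobenius at `𝔓₀`, `q_v = ℓ²`.) [cite: NeukirchANT1999, I §9 Prop. (9.4)–(9.5)] [cite: Marcus2018, Ch. 4, Thm. 29] -/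
theorem exists_frob_restrict_eq_sq_of_inertiaDeg_eq_two (hK : Module.finrank ℚ K = 2)
    {ℓ : HeightOneSpectrum (𝓞 ℚ)} {v : HeightOneSpectrum (𝓞 K)}
    (hv : v.asIdeal.under (𝓞 ℚ) = ℓ.asIdeal) (hf : v.asIdeal.inertiaDeg (𝓞 ℚ) = 2) :
    ∃ (φ : absoluteGaloisGroup K) (ρ : absoluteGaloisGroup ℚ),
      IsArithFrobAt (𝓞 K) φ (adicCompletionPrime K v) ∧
        ρ ∉ Set.range (absGaloisRestrict ℚ K) ∧ absGaloisRestrict ℚ K φ = ρ * ρ := by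
  haveI : FiniteDimensional ℚ K := Module.finite_of_finrank_eq_succ hK
  have h𝔔 := adicCompletionPrime_mem_primesAbove K v
  have h𝔓 : (adicCompletionPrime K v).comap (absIntegersMap ℚ K) ∈ ℓ.primesAbove :=
    comap_absIntegersMap_mem_primesAbove hv h𝔔
  obtain ⟨Φ, hΦ⟩ := exists_isArithFrobAt_of_mem_primesAbove_holds h𝔓
  -- `Φ ∉ res(Γ_K)`: a Frobenius in the image forces residue degree one
  have hΦnot : Φ ∉ Set.range (absGaloisRestrict ℚ K) := by
    rintro ⟨τ₀, rfl⟩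
    have h1 := inertiaDeg_eq_one_of_isArithFrobAt_absGaloisRestrict hv h𝔔 hΦ
    omega
  have hΦinv : Φ⁻¹ ∉ Set.range (absGaloisRestrict ℚ K) := by
    rintro ⟨x, hx⟩
    exact hΦnot ⟨x⁻¹, by rw [map_inv, hx, inv_inv]⟩
  -- `Φ² ∈ res(Γ_K)` (index two)
  obtain ⟨φ, hφ⟩ : Φ * Φ ∈ Set.range (absGaloisRestrict ℚ K) := by
    have := inv_mul_mem_range_absGaloisRestrict hK hΦinv hΦnot
    rwa [inv_inv] at this
  refine ⟨φ, Φ, ?_, hΦnot, hφ⟩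
  exact isArithFrobAt_of_absGaloisRestrict_eq_pow hv h𝔔 hΦ (by rw [hφ, hf, pow_two])

/-! ## Anticyclotomic towers: such places split completely; the away condition descends -/

variable {p : ℕ} [Fact p.Prime]

/-- **Places over INERT primes split completely in the anticyclotomic `ℤ_p`-extension**: for `K`
quadratic (`[K : ℚ] = 2`), `κ` anticyclotomic, and a finite place `v ∤ p` of residue degree `2` over
`ℚ`, the decomposition group `D_v` (of the chosen prime above `v`) lies in `ker κ = Gal(K̄/K_∞)`.
(`Gal(K_∞/ℚ)` is dihedral; `Frob_v = Frob_ℓ²` is inverted by conjugation by `Frob_ℓ`, hence trivial in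
the torsion-free `Γ`: `AnticyclotomicSplitPlaces` + `exists_frob_restrict_eq_sq_of_inertiaDeg_eq_two`.)
[cite: GreenbergLNM1716, §3 p. 87 (primes splitting completely)] [cite: Washington1997, Prop. 13.2 and §13.1] -/
theorem IsAnticyclotomic.decomp_le_kerSubgroup_of_inertiaDeg_eq_two (hK : Module.finrank ℚ K = 2)
    {κ : ZpExtension K p} (hκ : κ.IsAnticyclotomic) {ℓ : HeightOneSpectrum (𝓞 ℚ)}
    {v : HeightOneSpectrum (𝓞 K)} (hpv : ((p : ℕ) : 𝓞 K) ∉ v.asIdeal)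
    (hv : v.asIdeal.under (𝓞 ℚ) = ℓ.asIdeal) (hf : v.asIdeal.inertiaDeg (𝓞 ℚ) = 2) :
    decomp v ≤ κ.kerSubgroup := by
  obtain ⟨φ, ρ, hφ, hρ, hF⟩ := exists_frob_restrict_eq_sq_of_inertiaDeg_eq_two hK hv hf
  exact IsAnticyclotomic.decomp_le_kerSubgroup_of_frob_eq_sq hκ hpv hφ hρ hF

variable {M : Type} [AddCommGroup M] [DistribMulAction (absoluteGaloisGroup K) M]
  [TopologicalSpace M] [DiscreteTopology M]

/-- **… hence Castella's AWAY condition at a place over an inert prime DESCENDS from `K_∞` to `K`**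
(any discrete `Γ_K`-module `M`; `K` quadratic, `κ` anticyclotomic, `v ∤ p` of residue degree `2`):
for `c ∈ H¹(⊤, M) = H¹(K, M)`, `res_{K→K_∞} c` is locally trivial at the chosen place above `v` iff `c`
is locally trivial at `v`. [cite: GreenbergLNM1716, §3 p. 87 (primes splitting completely)] -/
theorem IsAnticyclotomic.resOfLe_mem_awayKer_iff_of_inertiaDeg_eq_two (hK : Module.finrank ℚ K = 2)
    {κ : ZpExtension K p} (hκ : κ.IsAnticyclotomic) {ℓ : HeightOneSpectrum (𝓞 ℚ)}
    {v : HeightOneSpectrum (𝓞 K)} (hpv : ((p : ℕ) : 𝓞 K) ∉ v.asIdeal)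
    (hv : v.asIdeal.under (𝓞 ℚ) = ℓ.asIdeal) (hf : v.asIdeal.inertiaDeg (𝓞 ℚ) = 2)
    (c : subgroupH1 (⊤ : Subgroup (absoluteGaloisGroup K)) M) :
    resOfLe M (le_top : κ.kerSubgroup ≤ ⊤) c ∈ awayKer κ.kerSubgroup M v ↔ c ∈ awayKer ⊤ M v :=
  resOfLe_mem_awayKer_iff_of_decomp_le v
    (IsAnticyclotomic.decomp_le_kerSubgroup_of_inertiaDeg_eq_two hK hκ hpv hv hf) c

end Summit.BirchSwinnertonDyer.Rank1Residual.X11b.AcSelmer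

end
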